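import Literature.Probability.Percolation.HutchcroftVolumeCovariance
import HarnessLib

/-!
# Exploration from a seed set: the decision trees of the OSSS proof of sharpness (Duminil-Copin–Raoufi–Tassion)

Source: H. Duminil-Copin, A. Raoufi, V. Tassion, *Sharp phase transition for the random-cluster and Potts
models via decision trees*, Ann. of Math. 189 (2019) 75–99, §3, proof of Lemma 3.2: "for any `k ∈ ⟦1,n⟧`
we wish to construct a decision tree `T` determining `𝟙_{0↔∂Λ_n}` such that for each `e = uv`,
`δ_e(T) ≤ μ[u ↔ ∂Λ_k] + μ[v ↔ ∂Λ_k]` … `T` corresponds first to an exploration of the connected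
components in `Λ_n` intersecting `∂Λ_k` that does not reveal any edge with both endpoints outside these
connected components"; the same construction is H. Duminil-Copin, *Sharp threshold phenomena in
statistical physics* (Jpn. J. Math. 14 (2019); arXiv:1810.03384), proof of Lemma 3.8.

This file formalises that decision tree as ONE legal query strategy (`Strategy`, `StrategyTree.lean`) on the
product cube `E → Bool` of a finite "graph with edge labels" — vertex type `W`, edge-label type `E`, incidence
`edge : W → W → Option E` (the setting of `HutchcroftGhostExploration.lean`, whose open-connection relation
`YReach` is reused) — for an arbitrary SEED SET `Z ⊆ W` in place of `∂Λ_k`: as long as some unqueried edge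
label has an endpoint joined by queried-open edges to a seed vertex, query it; otherwise halt.  We explore
EVERY edge touching the current cluster of `Z` (not only the edges leaving it, as in the printed text), so
that at halting the clusters of the seed vertices are completely determined and the strategy may halt
there; this only lowers the revealment.  Proved: legality (`strategy_legal`); HALTING CORRECTNESS
(`label_eq_of_halt`): if every open path from the source `o` to the target set `B` passes through `Z`
(`Separates`), the label `±1` according to "some seed vertex is joined by queried-open edges to both `o`
and a vertex of `B`" equals `2·𝟙{o ↔ B} − 1`; and the REVEALMENT property (`seedConn_of_query`): an edge is
queried only when one of its endpoints is joined to `Z` in the input, whence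
`δ_e ≤ P(a ↔ Z) + P(b ↔ Z)` for the endpoints `a, b` of `e` (`revealment_edge_le`).  The one-arm covariance
inequality itself (DRT Lemma 3.2 for product measures) is assembled in `OneArmOSSSCovariance.lean`.
-/

namespace Literature.Probability.Percolation

open Finset Function Literature.Probability.ODonnellSaksSchrammServedio2005
open Literature.Probability.ODonnellSaksSchrammServedio2005.Strategy
open GhostExploration

namespace SeedExploration

variable {W E : Type*} (edge : W → W → Option E)

/-- Queried-open adjacency of a PARTIAL edge assignment `σ`: an edge labelled `e` with `σ e = some true`.
[cite: DuminilCopinRaoufiTassion2019, §3 proof of Lemma 3.2 (the sets V_t, F_t of the decision tree)] -/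
def SAdj (σ : E → Option Bool) (a b : W) : Prop := a ≠ b ∧ ∃ e, edge a b = some e ∧ σ e = some true

/-- Queried-open connection of a partial edge assignment.
[cite: DuminilCopinRaoufiTassion2019, §3 proof of Lemma 3.2 (the sets V_t, F_t)] -/
def SReach (σ : E → Option Bool) (a b : W) : Prop := Relation.ReflTransGen (SAdj edge σ) a b

/-- A vertex is ACTIVE at the partial assignment `σ` (for the seed set `Z`) when it is joined by
queried-open edges to a seed vertex: "`V_t` represents the set of vertices that the decision tree found to
be connected to `∂Λ_k`". [cite: DuminilCopinRaoufiTassion2019, §3 proof of Lemma 3.2 (the set V_t)] -/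
def Active (Z : Set W) (σ : E → Option Bool) (a : W) : Prop := ∃ u ∈ Z, SReach edge σ u a

/-- "`u ↔ Z`": in the (total) edge configuration `y`, the vertex `a` is joined by an open path to a seed
vertex. [cite: DuminilCopinRaoufiTassion2019, §3 Lemma 3.2 (the events u ↔ ∂Λ_k)] -/
def SeedConn (Z : Set W) (y : E → Bool) (a : W) : Prop := ∃ u ∈ Z, YReach edge y u a

/-- "`o ↔ B`": the source is joined by an open path to some target vertex (the Boolean function
`𝟙_{0↔∂Λ_n}` determined by the trees). [cite: DuminilCopinRaoufiTassion2019, §3 Lemma 3.2 (the function 𝟙_{0↔∂Λ_n})] -/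
def Conn (o : W) (B : Set W) (y : E → Bool) : Prop := ∃ b ∈ B, YReach edge y o b

/-- The seed set SEPARATES the source from the targets: every open path from `o` to `B` passes through
`Z` (for `o = 0`, `B = ∂Λ_n`, `Z = ∂Λ_k`, `1 ≤ k ≤ n`), in the form used by the proof: a seed vertex is
joined to both `o` and the target. [cite: DuminilCopinRaoufiTassion2019, §3 proof of Lemma 3.2 (T determines 𝟙_{0↔∂Λ_n})] -/
def Separates (Z : Set W) (o : W) (B : Set W) : Prop :=
  ∀ (y : E → Bool) (b : W), b ∈ B → YReach edge y o b → ∃ u ∈ Z, YReach edge y u o ∧ YReach edge y u b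

open Classical in
/-- THE SEED-EXPLORATION STRATEGY (DRT's tree `T` for the seed set `Z`, exploring every edge touching the
current clusters of the seeds): query an unqueried edge label with an active endpoint if any; else halt.
[cite: DuminilCopinRaoufiTassion2019, §3 proof of Lemma 3.2 (construction of T)] -/
noncomputable def strategy (Z : Set W) (σ : E → Option Bool) : Option E :=
  if h : ∃ e, σ e = none ∧ ∃ a b, edge a b = some e ∧ Active edge Z σ a then some (Classical.choose h)
  else none

open Classical in
/-- Leaf labels for source `o` and targets `B`: `+1` if some seed vertex is joined by queried-open edges to
`o` and to a vertex of `B`, `−1` otherwise. [cite: DuminilCopinRaoufiTassion2019, §3 proof of Lemma 3.2 (T determines 𝟙_{0↔∂Λ_n})] -/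
noncomputable def label (Z : Set W) (o : W) (B : Set W) (σ : E → Option Bool) : ℝ :=
  if ∃ u ∈ Z, SReach edge σ u o ∧ ∃ b ∈ B, SReach edge σ u b then 1 else -1

open Classical in
/-- The `±1` form `2·𝟙{o ↔ B} − 1` of the target Boolean function.
[cite: DuminilCopinRaoufiTassion2019, §3 Lemma 3.2 (the function 𝟙_{0↔∂Λ_n})] -/
noncomputable def gpm (o : W) (B : Set W) (y : E → Bool) : ℝ := if Conn edge o B y then 1 else -1

/-- `|2·𝟙 − 1| ≤ 1`. [cite: DuminilCopinRaoufiTassion2019, §3 Lemma 3.2 (𝟙_{0↔∂Λ_n} is Boolean)] -/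
theorem abs_gpm_le (o : W) (B : Set W) (y : E → Bool) : |gpm edge o B y| ≤ 1 := by
  unfold gpm; split_ifs <;> simp

/-- The seed-exploration strategy is legal (queries only unqueried coordinates).
[cite: DuminilCopinRaoufiTassion2019, §3 proof of Lemma 3.2 (T is a decision tree)] -/
theorem strategy_legal (Z : Set W) : Legal (strategy edge Z) := by
  intro σ i hi
  unfold strategy at hi
  split_ifs at hi with h
  cases hi; exact (Classical.choose_spec h).1

variable {edge}

/-- Queried-open connections of a state consistent with the input are open connections of the input.
[cite: DuminilCopinRaoufiTassion2019, §3 proof of Lemma 3.2 (V_t is joined to ∂Λ_k by open edges)] -/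
theorem yReach_of_sReach {σ : E → Option Bool} {x : E → Bool} (hc : Consistent σ x) {a b : W}
    (h : SReach edge σ a b) : YReach edge x a b := by
  unfold SReach at h; unfold YReach
  refine Relation.ReflTransGen.mono (fun c d hcd => ?_) _ _ h
  obtain ⟨hne, e, he, hσ⟩ := hcd
  exact ⟨hne, e, he, hc _ _ hσ⟩

/-- An active vertex of a state consistent with the input is joined to the seed set in the input.
[cite: DuminilCopinRaoufiTassion2019, §3 proof of Lemma 3.2 (V_t ⊆ clusters of ∂Λ_k)] -/
theorem seedConn_of_active {Z : Set W} {σ : E → Option Bool} {x : E → Bool} (hc : Consistent σ x)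
    {a : W} (h : Active edge Z σ a) : SeedConn edge Z x a := by
  obtain ⟨u, hu, hr⟩ := h
  exact ⟨u, hu, yReach_of_sReach hc hr⟩

/-- At a state with no pending edge, an open path of the input from a seed vertex consists of queried-open
edges ("as long as we are in the first case, we are still discovering the connected components of
`∂Λ_k`"). [cite: DuminilCopinRaoufiTassion2019, §3 proof of Lemma 3.2 (end of the first phase)] -/
theorem sReach_of_yReach_of_noPending {Z : Set W} {σ : E → Option Bool} {x : E → Bool}
    (hc : Consistent σ x) (h' : ∀ e, σ e = none → ∀ a b, edge a b = some e → ¬Active edge Z σ a)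
    {u : W} (hu : u ∈ Z) {w : W} (hr : YReach edge x u w) : SReach edge σ u w := by
  unfold YReach at hr; unfold SReach
  induction hr with
  | refl => exact Relation.ReflTransGen.refl
  | tail _ hbc ih =>
    obtain ⟨hne, e, he, hxe⟩ := hbc
    have hact : Active edge Z σ _ := ⟨u, hu, ih⟩
    have hq : σ e ≠ none := fun hnone => h' e hnone _ _ he hact
    have hσe : σ e = some true := by
      cases hq' : σ e with
      | none => exact absurd hq' hq
      | some b' =>
        have hb : x e = b' := hc _ _ hq'
        have hb' : b' = true := by rw [← hb]; exact hxe
        rw [hb']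
    exact Relation.ReflTransGen.tail ih ⟨hne, e, he, hσe⟩

/-- Queried-open connection is symmetric for a symmetric incidence.
[cite: DuminilCopinRaoufiTassion2019, §3 proof of Lemma 3.2 (undirected graph)] -/
theorem sReach_symm (hsymm : ∀ a b, edge a b = edge b a) {σ : E → Option Bool} {a b : W}
    (h : SReach edge σ a b) : SReach edge σ b a := by
  unfold SReach at h ⊢
  induction h with
  | refl => exact Relation.ReflTransGen.refl
  | tail _ hcd ih =>
    obtain ⟨hne, e, he, hy⟩ := hcd
    exact Relation.ReflTransGen.head ⟨hne.symm, e, by rw [hsymm]; exact he, hy⟩ ih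

/-- HALTING CORRECTNESS: if `Z` separates `o` from `B` and the incidence is symmetric, then at a halting
state consistent with the input the label equals `2·𝟙{o ↔ B} − 1` — "`T` determines `𝟙_{0↔∂Λ_n}`".
[cite: DuminilCopinRaoufiTassion2019, §3 proof of Lemma 3.2 (T determines 𝟙_{0↔∂Λ_n})] -/
theorem label_eq_of_halt (hsymm : ∀ a b, edge a b = edge b a) {Z : Set W} {o : W} {B : Set W}
    (hsep : Separates edge Z o B) (σ : E → Option Bool) (x : E → Bool) (hc : Consistent σ x)
    (hh : strategy edge Z σ = none) : label edge Z o B σ = gpm edge o B x := by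
  unfold strategy at hh
  split_ifs at hh with h
  simp only [not_exists, not_and] at h
  have key : (∃ u ∈ Z, SReach edge σ u o ∧ ∃ b ∈ B, SReach edge σ u b) ↔ Conn edge o B x := by
    constructor
    · rintro ⟨u, _, huo, b, hb, hub⟩
      refine ⟨b, hb, ?_⟩
      have h1 : YReach edge x o u := yReach_symm hsymm (yReach_of_sReach hc huo)
      have h2 : YReach edge x u b := yReach_of_sReach hc hub
      unfold YReach at h1 h2 ⊢
      exact h1.trans h2
    · rintro ⟨b, hb, hob⟩
      obtain ⟨u, hu, huo, hub⟩ := hsep x b hb hob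
      have h'' : ∀ e, σ e = none → ∀ a b, edge a b = some e → ¬Active edge Z σ a :=
        fun e he a b hab => h e he a b hab
      exact ⟨u, hu, sReach_of_yReach_of_noPending hc h'' hu huo, b, hb,
        sReach_of_yReach_of_noPending hc h'' hu hub⟩
  unfold label gpm
  by_cases hA : ∃ u ∈ Z, SReach edge σ u o ∧ ∃ b ∈ B, SReach edge σ u b
  · rw [if_pos hA, if_pos (key.mp hA)]
  · rw [if_neg hA, if_neg (fun hG => hA (key.mpr hG))]

/-- REVEALMENT: an edge label is queried only at a state where one endpoint of the edge is active, hence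
(in the input) joined to the seed set — "an edge is revealed only if one of its endpoints is connected to
`∂Λ_k`". [cite: DuminilCopinRaoufiTassion2019, §3 proof of Lemma 3.2 (eq. (3.?) δ_e(T) ≤ μ[u↔∂Λ_k] + μ[v↔∂Λ_k])] -/
theorem seedConn_of_query {Z : Set W} {σ : E → Option Bool} {x : E → Bool} (hc : Consistent σ x)
    {e : E} (hq : strategy edge Z σ = some e) : ∃ a b, edge a b = some e ∧ SeedConn edge Z x a := by
  unfold strategy at hq
  split_ifs at hq with h
  simp only [Option.some.injEq] at hq
  obtain ⟨_, a, b, hab, hact⟩ := Classical.choose_spec h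
  rw [hq] at hab
  exact ⟨a, b, hab, seedConn_of_active hc hact⟩

variable [Fintype E] [DecidableEq E]

open Classical in
/-- REVEALMENT BOUND: if the label `e` is carried by at most the pair `{a₀, b₀}` (endpoint uniqueness),
then `δ_e ≤ P(a₀ ↔ Z) + P(b₀ ↔ Z)`. [cite: DuminilCopinRaoufiTassion2019, §3 proof of Lemma 3.2 (δ_e(T) ≤ μ[u↔∂Λ_k] + μ[v↔∂Λ_k])] -/
theorem revealment_edge_le (p : E → ℝ) (h0 : ∀ i, 0 ≤ p i) (h1 : ∀ i, p i ≤ 1) (Z : Set W) (o : W)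
    (B : Set W) (e : E) (a₀ b₀ : W) (hends : ∀ a b, edge a b = some e → a = a₀ ∨ a = b₀) :
    revealment p (strategy edge Z) (label edge Z o B) e
      ≤ (∑ x, wt p x * (if SeedConn edge Z x a₀ then 1 else 0))
        + ∑ x, wt p x * (if SeedConn edge Z x b₀ then 1 else 0) := by
  have h := revealment_le h0 h1 (strategy edge Z) (label edge Z o B) e
    (fun x => SeedConn edge Z x a₀ ∨ SeedConn edge Z x b₀) (fun σ x hc hq => by
      obtain ⟨a, b, hab, hg⟩ := seedConn_of_query hc hq
      rcases hends a b hab with rfl | rfl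
      · exact Or.inl hg
      · exact Or.inr hg)
  refine h.trans ?_
  rw [← Finset.sum_add_distrib]
  refine Finset.sum_le_sum fun x _ => ?_
  rw [← mul_add]
  refine mul_le_mul_of_nonneg_left ?_ (wt_nonneg h0 h1 x)
  by_cases ha : SeedConn edge Z x a₀ <;> by_cases hb : SeedConn edge Z x b₀ <;> simp [ha, hb]

/-- An edge label carried by no pair is never queried: `δ_e ≤ 0`.
[cite: DuminilCopinRaoufiTassion2019, §3 proof of Lemma 3.2 (only edges of the graph are queried)] -/
theorem revealment_edge_le_zero (p : E → ℝ) (h0 : ∀ i, 0 ≤ p i) (h1 : ∀ i, p i ≤ 1) (Z : Set W)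
    (o : W) (B : Set W) (e : E) (hno : ∀ a b, edge a b ≠ some e) :
    revealment p (strategy edge Z) (label edge Z o B) e ≤ 0 := by
  have h := revealment_le h0 h1 (strategy edge Z) (label edge Z o B) e (fun _ => False)
    (fun σ x hc hq => by
      obtain ⟨a, b, hab, _⟩ := seedConn_of_query hc hq
      exact hno a b hab)
  simpa using h

end SeedExploration

end Literature.Probability.Percolation
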